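import Literature.NumberTheory.EllipticCurves.Rubin1991.TwoVariableCMLines
import HarnessLib

/-!
# No receptacle-level transport of `μ = 0` from the outer axis (the line carrying the published CM
# `μ = 0` theorems) or from two-variable unit content to the cyclotomic (inner) axis of the
# Katz–de Shalit two-variable receptacle `𝒪_{ℂ_p}⟦T₁⟧⟦T₂⟧`

Cell `bsd-smallim`, second prover lane `bsd-smallim-kolyx` on crux stmt-BirchSwinnertonDyer-19234
`MuZeroCMCurves` (route `SmallImageMuTransfer`), testing the strategy «cite-and-transport the CM `μ = 0`
theorems (Gillard / Oukhaba–Viguié) as Literature facts by name and descend to the curve».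

## What is typed, and what it answers

The tree's two-variable receptacle for the Katz–de Shalit measure along a `ℤ_p²`-tower of an imaginary
quadratic `K` is `G ∈ 𝒪_{ℂ_p}⟦T₁⟧⟦T₂⟧` (outer `T₁`, inner `T₂`, `1 + T_i ↔ γ_i` for a generator PAIR
`(κ₁, κ₂; γ₁, γ₂)` with `κ₂` cyclotomic: `Rubin1991.IsKatzMeasure₂`, `Rubin1991/TwoVariableCMLines.lean`).
In it:
* the INNER axis `T₁ = 0`, `PowerSeries.constantCoeff G`, is the CYCLOTOMIC line
  (`IsKatzMeasure₂.isKatzBranch_constantCoeff`); by (L3)/(L4) of `TwoVariableCMLines`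
  (`exists_norm_coeff_eq_one_iff_hasUnitContent_constantCoeff`) the conclusion of `MuZeroCMCurves` at a
  CM pair `(A, p)` IS `HasUnitContent (constantCoeff G)` for the `ψ_A⁻¹`-twisted frame — the open content
  of the crux (KOLY-MEMO v1.9.5 §5.13: `=` the `𝔐_H(G)`-conjecture for `X(A/K(A[p^∞]))`,
  Coates–Fukaya–Kato–Sujatha–Venjakob 2005 Cor. 5.5; Coates–Sujatha 2012 §1: «even in the special case when
  `E` is an elliptic curve over `ℚ` with complex multiplication … we still do not know how to prove the
  `𝔐_H(G)`-conjecture»);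
* the OUTER axis `T₂ = 0`, `G.map PowerSeries.constantCoeff`, is the line of characters factoring
  through `κ₁`.  The frame allows ANY complement `κ₁` of the cyclotomic `κ₂`; for `κ₁ =` the
  `ℤ_p`-extension of `K` unramified outside `𝔭 = v` the outer axis is the SPLIT-PRIME LINE on which the
  published CM `μ = 0` theorems live — Gillard 1985 (Crelle 358) / Schneps 1987 (J. Number Theory 25) =
  de Shalit 1987 III.2.12 (`p ≥ 5` split: every branch of the one-variable `𝔭`-adic measure has `μ = 0`),
  Oukhaba–Viguié 2016 (Forum Math. 28: the same at `p = 2, 3`); for `κ₁` anticyclotomic it is the line of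
  Hida 2010 Thm. I (`Hida2010MuInvariant.thmI_mu_katzBranch_reflect_eq_zero`);
* two-variable unit content, `∃ i k, IsUnit [T₁^i T₂^k]G`, is the shape of the two-variable `μ = 0`
  recorded in Coates–Fukaya–Kato–Sujatha–Venjakob 2005, proof of Cor. 5.5 («the thesis of Schneps [Sc]
  implies `μ_{G_L}(X(E/F_∞)) = 0`», [Sc] = Schneps 1987, J. Number Theory 25, whose Thm. IV is the
  ONE-variable `μ(X_∞) = 0` on the Coates–Wiles tower `K(E_{𝔭^∞})` and whose Thm. I is the Sinnott-type
  `Γ`-transform formula; two-variable unit content follows from unit content on any ONE line, since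
  reduction modulo `𝔪` commutes with restriction to a line).

THEOREM (`exists_outerAxis_twoVariable_unitContent_not_innerAxis`, kernel): there is a `G` in the
receptacle — the outer variable `G = T₁` itself — with unit content on the outer axis AND two-variable
unit content, yet with NO unit content on the inner axis nor on any line `T₁ = c`, `‖c‖ < 1`, parallel to
it (`IntSeries.lineSubst c G = C c`).  Hence no implication of the shape «outer-axis `μ = 0` (+ two-variable
`μ = 0`) ⟹ inner-axis `μ = 0`» holds at the level of the receptacle: a transport of the Gillard /
Oukhaba–Viguié / Schneps / Hida theorems to the cyclotomic axis must use arithmetic of the specific measure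
that the typed frames do not carry (the negative companion of the PROVED parallel-line lemma (L2)
`IntSeries.hasUnitContent_lineSubst_iff`, which transports unit content between PARALLEL lines only).
This is the kernel form of KOLY-MEMO §5.13.C(1) («`Ḡ = S̄·(unit)` is consistent with every theorem in
print») and of the CAVEAT in the module docstring of `TwoVariableCMLines` (there for `G = T₁ + p`).

Nothing here asserts or refutes `MuZeroCMCurves`; no `μ` of an arithmetic object is computed.
[cite: deShalit1987, II.4.17 (51)–(54) (p. 77–78); III.2.12 (p. 103)]
[cite: GreenbergVatsal2000, p. 2, (1)–(2)]
-/

-- D-0017: single-problem summit, so `Summit.BirchSwinnertonDyer.BirchSwinnertonDyer.…` repeats a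
-- namespace BY DESIGN.
set_option linter.dupNamespace false
set_option autoImplicit false

noncomputable section

open Literature.NumberTheory.EllipticCurves
open Literature.NumberTheory.EllipticCurves.GreenbergVatsal2000

namespace Summit.BirchSwinnertonDyer.BirchSwinnertonDyer.Theorems.MuZeroCMCurves.Negative

variable {p : ℕ} [Fact p.Prime]

/-- The coefficients of the witness `G = T₁` (the outer variable of `𝒪_{ℂ_p}⟦T₁⟧⟦T₂⟧`):
`[T₁^i T₂^k] T₁ = 1` if `(i, k) = (1, 0)` and `0` otherwise. [folklore] -/
theorem coeff_coeff_outerX (i k : ℕ) :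
    PowerSeries.coeff k (PowerSeries.coeff i
        (PowerSeries.X : PowerSeries (PowerSeries (PadicComplexInt p)))) =
      if i = 1 ∧ k = 0 then 1 else 0 := by
  rw [PowerSeries.coeff_X]
  by_cases hi : i = 1
  · subst hi
    by_cases hk : k = 0
    · subst hk; simp
    · simp [hk, PowerSeries.coeff_one]
  · simp [hi]

/-- **Outer axis: unit content.** `(T₁).map constantCoeff = T₁ ∈ 𝒪⟦T₁⟧` has the unit coefficient
`[T₁¹] = 1`.  In the frame `(κ₁, κ₂) = (split-prime line, cyclotomic)` the outer axis is the line of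
Gillard–Schneps–de Shalit III.2.12 / Oukhaba–Viguié; in the frame `(anticyclotomic, cyclotomic)` it is
Hida's line. [cite: deShalit1987, III.2.12 (p. 103)] -/
theorem hasUnitContent_outerAxis_outerX :
    HasUnitContent ((PowerSeries.X : PowerSeries (PowerSeries (PadicComplexInt p))).map
      PowerSeries.constantCoeff) := by
  refine ⟨1, ?_⟩
  rw [PowerSeries.map_X, PowerSeries.coeff_X]
  simp

/-- **Two-variable unit content** (the shape of the two-variable `μ = 0`, CFKSV 2005 proof of Cor. 5.5 /
Schneps 1987 Thm. IV on one line): `[T₁¹ T₂⁰] T₁ = 1` is a unit.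
[cite: deShalit1987, II.4.17 (51)–(54) (p. 77–78)] -/
theorem isUnit_coeff_coeff_outerX :
    IsUnit (PowerSeries.coeff 0 (PowerSeries.coeff 1
      (PowerSeries.X : PowerSeries (PowerSeries (PadicComplexInt p))))) := by
  rw [coeff_coeff_outerX]
  simp

/-- **Every line parallel to the inner (cyclotomic) axis sees only a constant**:
`lineSubst c T₁ = C c` (`[T₂^k] = ∑_i [T₁^i T₂^k]T₁ · c^i = c·[k = 0]`).
[cite: deShalit1987, II.4.17 (51)–(54) (p. 77–78)] -/
theorem lineSubst_outerX (c : PadicComplexInt p) :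
    IntSeries.lineSubst c (PowerSeries.X : PowerSeries (PowerSeries (PadicComplexInt p))) =
      PowerSeries.C c := by
  ext k
  rw [IntSeries.coe_coeff_lineSubst, tsum_eq_single 1 (fun i hi => by simp [coeff_coeff_outerX, hi]),
    coeff_coeff_outerX, PowerSeries.coeff_C]
  by_cases hk : k = 0
  · subst hk; simp
  · simp [hk]

/-- **Inner (cyclotomic) axis: NO unit content** — `constantCoeff T₁ = 0`. [folklore] -/
theorem not_hasUnitContent_innerAxis_outerX :
    ¬ HasUnitContent (PowerSeries.constantCoeff
      (PowerSeries.X : PowerSeries (PowerSeries (PadicComplexInt p)))) := by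
  rintro ⟨n, hn⟩
  rw [PowerSeries.constantCoeff_X, map_zero] at hn
  exact not_isUnit_zero hn

/-- **No parallel line `T₁ = c` (`‖c‖ < 1`) has unit content either** (by the parallel-line lemma (L2),
or directly: `C c` with `‖c‖ < 1` has no unit coefficient). [cite: GreenbergVatsal2000, p. 2, (2)] -/
theorem not_hasUnitContent_lineSubst_outerX {c : PadicComplexInt p} (hc : ‖(c : ℂ_[p])‖ < 1) :
    ¬ HasUnitContent (IntSeries.lineSubst c
      (PowerSeries.X : PowerSeries (PowerSeries (PadicComplexInt p)))) := by
  rw [IntSeries.hasUnitContent_lineSubst_iff _ hc]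
  exact not_hasUnitContent_innerAxis_outerX

/-- **THEOREM (no receptacle-level transport to the cyclotomic axis).** There is `G ∈ 𝒪_{ℂ_p}⟦T₁⟧⟦T₂⟧`
with unit content on the OUTER axis (the split-prime line of Gillard 1985 / Schneps 1987 / de Shalit
III.2.12 / Oukhaba–Viguié 2016 when `κ₁` is the `𝔭`-unramified `ℤ_p`-extension; Hida's anticyclotomic
line when `κ₁` is anticyclotomic) and with TWO-VARIABLE unit content (CFKSV 2005, proof of Cor. 5.5, from
Schneps 1987 Thm. IV), but WITHOUT
unit content on the inner (cyclotomic) axis and on every line parallel to it.  So the implication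
«outer-axis `μ = 0` ∧ two-variable `μ = 0` ⟹ cyclotomic `μ = 0`», which a cite-and-transport proof of
`MuZeroCMCurves` inside the typed frames would need, is false for the receptacle; only PARALLEL lines
transport (`IntSeries.hasUnitContent_lineSubst_iff`).  Witness: `G = T₁`.
[cite: deShalit1987, II.4.17 (51)–(54) (p. 77–78); III.2.12 (p. 103)] [cite: GreenbergVatsal2000, p. 2, (2)] -/
theorem exists_outerAxis_twoVariable_unitContent_not_innerAxis :
    ∃ G : PowerSeries (PowerSeries (PadicComplexInt p)),
      HasUnitContent (G.map PowerSeries.constantCoeff) ∧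
      (∃ i k : ℕ, IsUnit (PowerSeries.coeff k (PowerSeries.coeff i G))) ∧
      ¬ HasUnitContent (PowerSeries.constantCoeff G) ∧
      ∀ c : PadicComplexInt p, ‖(c : ℂ_[p])‖ < 1 → ¬ HasUnitContent (IntSeries.lineSubst c G) :=
  ⟨PowerSeries.X, hasUnitContent_outerAxis_outerX, ⟨1, 0, isUnit_coeff_coeff_outerX⟩,
    not_hasUnitContent_innerAxis_outerX, fun _ hc => not_hasUnitContent_lineSubst_outerX hc⟩

/-- **COROLLARY (the transport implication is refuted as a schema).** It is NOT the case that for every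
`G` in the receptacle, outer-axis unit content and two-variable unit content imply inner-axis unit
content. [cite: deShalit1987, II.4.17 (51)–(54) (p. 77–78)] -/
theorem not_forall_outerAxis_imp_innerAxis :
    ¬ ∀ G : PowerSeries (PowerSeries (PadicComplexInt p)),
      HasUnitContent (G.map PowerSeries.constantCoeff) →
      (∃ i k : ℕ, IsUnit (PowerSeries.coeff k (PowerSeries.coeff i G))) →
      HasUnitContent (PowerSeries.constantCoeff G) := by
  intro h
  obtain ⟨G, h1, h2, h3, -⟩ :=
    exists_outerAxis_twoVariable_unitContent_not_innerAxis (p := p)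
  exact h3 (h G h1 h2)

end Summit.BirchSwinnertonDyer.BirchSwinnertonDyer.Theorems.MuZeroCMCurves.Negative

end
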